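import Summits.Ventures.HodgeRepro.Tier3Weierstrass
import Summits.Ventures.HodgeRepro.Tier3R2Pinning

/-!
# Tier 3, T3.2 — (R2) ∧ (R1): the whole pinning chain as ONE kernel statement, modulo the named input
(seat t3-p3, gen 2)

Blind re-derivation cell `pub-hodge-repro`, Tier-3 seat `t3-p3` (route/TIER3.md v1.1 §1 item 3, §3 row R-B;
paper: proofs/t3-p3/R2-PINNING.md §4, §8.5, §10.2 (v)–(vi)).  The chain that closes (R2) ∧ (R1) on a face,
line by line, is

  ONE value `L(1, λ_j ν₀) ≠ 0` (the named input R-B)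
    ⇒ the branch element `G_j ∈ O⟦T⟧` of the Katz measure on the degree-one line `Γ_𝔭 ≅ ℤ_p` is non-zero
      (interpolation formula with non-vanishing Euler / Gauss-sum factors: Hsieh 2014 Prop 4.9 + Lemma E)
    ⇒ Weierstrass: `G_j(ζ_ν − 1) = 0` for finitely many `ν` (tree `Tier3Weierstrass`)
    ⇒ `L(1, λ_j ν) ≠ 0` for all but finitely many `ν ∈ Ξ_𝔭`, each `j`;
  the root numbers are `+1` for all but finitely many `ν` (sign constancy on a split line, BHTY p0034:L74,
  after the quadratic normalisation (S3));
  four cofinite good sets meet in an infinite set, and the constant twist vector `(ν, ν, ν, ν)` satisfies N2.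

The two landed files hold the links (`PowerSeries.finite_vanishing_of_interpolation`, t3-p4; `pinning_of_cofinite`,
t3-p3).  This file composes them, so that the hypotheses of the WHOLE chain are visible in one signature:

* `cofinite_good_of_interpolation` — one line: interpolation data + ONE non-zero value + finitely many bad signs
  ⇒ the good set `{ν | L ν ≠ 0 ∧ ε ν = 1}` is cofinite;
* `infinite_common_good_of_interpolation` — finitely many lines over the same infinite twist set `Ξ`: infinitely many
  `ν` are good for EVERY line;
* `four_line_pinning_of_interpolation` — the face: four lines, the common `ν`, and N2 for the constant vector.

HONESTY.  `hL` (the interpolation formula), `h0` (one non-vanishing value per line — TIER3.md's R-B, NOT closed in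
print) and `hε` (sign cofiniteness) are HYPOTHESES; nothing about Hecke characters or `L`-values is proved here.
Nothing here says anything about the status of the Hodge conjecture for CM abelian varieties, which is NOT proved.
-/

set_option autoImplicit false

namespace Summit.Ventures.HodgeRepro.T3.R2Pinning

open PowerSeries

section Glue

variable {A : Type*} [CommRing A] [IsDomain A] [IsDiscreteValuationRing A]
  [IsAdicComplete (IsLocalRing.maximalIdeal A) A] [UniformSpace A] [IsUniformAddGroup A]
  [IsTopologicalRing A]
variable {B : Type*} [CommRing B] [IsDomain B] [UniformSpace B] [IsUniformAddGroup B] [T2Space B]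
  [CompleteSpace B] [IsTopologicalRing B] [IsLinearTopology B B] [Algebra A B] [ContinuousSMul A B]
variable {Ξ : Type*}

/-- **One line.** Interpolation data on the twist set `Ξ` (`ζ ν ∈ B` the root of unity of `ν`, injective, with
`ζ ν − 1` topologically nilpotent; `G` the branch element; `L ν = u ν · G(ζ ν − 1)` with non-zero factors `u ν`), ONE
non-vanishing value, and finitely many twists of bad sign: then the good set `{ν | L ν ≠ 0 ∧ ε ν = 1}` is cofinite. -/
theorem cofinite_good_of_interpolation (hinj : Function.Injective (algebraMap A B))
    (ζ : Ξ → B) (hζ : Function.Injective ζ) (hev : ∀ ν, HasEval (ζ ν - 1)) (G : PowerSeries A)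
    (L u : Ξ → B) (hu : ∀ ν, u ν ≠ 0) (hL : ∀ ν, L ν = u ν * aeval (hev ν) G) (h0 : ∃ ν₀, L ν₀ ≠ 0)
    (ε : Ξ → ℤˣ) (hε : {ν | ε ν ≠ 1}.Finite) :
    {ν | L ν ≠ 0 ∧ ε ν = 1}ᶜ.Finite := by
  have hfin := finite_vanishing_of_interpolation (B := B) hinj ζ hζ hev G L u hu hL h0
  refine (hfin.union hε).subset ?_
  intro ν hν
  simp only [Set.mem_compl_iff, Set.mem_setOf_eq, not_and_or, not_not] at hν
  simp only [Set.mem_union, Set.mem_setOf_eq]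
  exact hν

/-- **Finitely many lines over one infinite twist set.** With the data of `cofinite_good_of_interpolation` for each
line `j` (ONE non-zero value per line), infinitely many `ν ∈ Ξ` are good for every line at once. -/
theorem infinite_common_good_of_interpolation [Infinite Ξ] {ι : Type*} [Finite ι]
    (hinj : Function.Injective (algebraMap A B))
    (ζ : Ξ → B) (hζ : Function.Injective ζ) (hev : ∀ ν, HasEval (ζ ν - 1)) (G : ι → PowerSeries A)
    (L u : ι → Ξ → B) (hu : ∀ j ν, u j ν ≠ 0) (hL : ∀ j ν, L j ν = u j ν * aeval (hev ν) (G j))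
    (h0 : ∀ j, ∃ ν₀, L j ν₀ ≠ 0) (ε : ι → Ξ → ℤˣ) (hε : ∀ j, {ν | ε j ν ≠ 1}.Finite) :
    {ν : Ξ | ∀ j, L j ν ≠ 0 ∧ ε j ν = 1}.Infinite := by
  have h := infinite_iInter_of_cofinite (fun j => {ν : Ξ | L j ν ≠ 0 ∧ ε j ν = 1}) fun j =>
    cofinite_good_of_interpolation (B := B) hinj ζ hζ hev (G j) (L j) (u j) (hu j) (hL j) (h0 j) (ε j) (hε j)
  convert h using 1
  ext ν
  simp

/-- **The face (R2-PINNING.md §4 / §10.2 (v)–(vi)).** Four lines `j : Fin 4` over the split degree-one family `Ξ`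
(an infinite commutative group): interpolation data per line, ONE non-vanishing central value per line (R-B), finitely
many bad signs per line.  Then infinitely many `ν` make all four central values non-zero with all four root numbers
`+1`, and the constant twist vector `(ν, ν, ν, ν)` satisfies N2 (`η 0 * η 1 = η 2 * η 3`): (R2) ∧ (R1) with one common
twist, modulo exactly the hypotheses displayed. -/
theorem four_line_pinning_of_interpolation [Infinite Ξ] [CommGroup Ξ]
    (hinj : Function.Injective (algebraMap A B))
    (ζ : Ξ → B) (hζ : Function.Injective ζ) (hev : ∀ ν, HasEval (ζ ν - 1)) (G : Fin 4 → PowerSeries A)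
    (L u : Fin 4 → Ξ → B) (hu : ∀ j ν, u j ν ≠ 0) (hL : ∀ j ν, L j ν = u j ν * aeval (hev ν) (G j))
    (h0 : ∀ j, ∃ ν₀, L j ν₀ ≠ 0) (ε : Fin 4 → Ξ → ℤˣ) (hε : ∀ j, {ν | ε j ν ≠ 1}.Finite) :
    {ν : Ξ | ∀ j, L j ν ≠ 0 ∧ ε j ν = 1}.Infinite ∧
      ∀ ν ∈ {ν : Ξ | ∀ j, L j ν ≠ 0 ∧ ε j ν = 1}, ∀ η : Fin 4 → Ξ, (∀ j, η j = ν) →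
        η 0 * η 1 = η 2 * η 3 :=
  ⟨infinite_common_good_of_interpolation (B := B) hinj ζ hζ hev G L u hu hL h0 ε hε,
    fun ν _ η hη => by rw [hη 0, hη 1, hη 2, hη 3]⟩

end Glue

end Summit.Ventures.HodgeRepro.T3.R2Pinning
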